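import Literature.AnabelianGeometry.SemiGraphs.PreimageComponentTransport
import Literature.AnabelianGeometry.SemiGraphs.PreimageComponentsDoubleCosets
import HarnessLib

/-!
# (D3) `covering_subgraphComponents_doubleCosets` from matched stabilizers ([SemiAnbd] Cor. 2.7 (i), p. 30)

Mochizuki, *Semi-graphs of anabelioids*, Publ. RIMS **42** (2006), §2, proof of Corollary 2.7 (i),
author's manuscript p. 30 [cite: MochizukiSemiAnbd2006, Cor. 2.7(i) p.30]; Remark 2.2.1 p. 24 (images
of fundamental groups along a finite étale covering are decomposition groups = stabilizers).

abc-iut cell, layer L3, the (ASM) piece of the D3b four-way cut (ruling α7-1/α13-1; this seat =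
abc-iut-w5-d041).  PROOF-ONLY file (no definitions, no new named facts).  The dictionary fact (D3)
(`covering_subgraphComponents_doubleCosets`, `FiniteEtaleCoveringDictionary.lean`, abc-iut-L3-d3) has
four clauses: (P1) components of `φ⁻¹(ℍ)` ↔ `Π_ℍ \ Π_𝒢 / Π′`, (P2) the component through `v′`
exists, (P3) `ι(Π_{K₀}) = Π′ ∩ Π_ℍ` at the base vertex, (P4) at every vertex `w″` of every component
`K`, through any transport of basepoints, `ι(Π_K) = Π′ ∩ g⁻¹ Π_ℍ g`.  (P1)+(P2) are proved for every
locally-and-globally attached covering (`covering_subgraphComponents_count_one`,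
`PreimageComponentsDoubleCosets.lean`, abc-iut-w5-d041); abc-iut-L6-t17's bridge and basepoint
transport (`PreimageComponentTransport.lean`) reduce (P3)/(P4) to ONE input per vertex `w″ ∈ K`:

  (ST) «matched stabilizers»: for constituent basepoints `(F″, F₂, e₂)` at `w″ ↦ u ∈ ℍ` there is a
  point `a` of the fibre `F₂(A_u)` with `ι_ψ(Π_K) = Stab_{Π_ℍ}(a)` for the restricted morphism
  `ψ := φ|_K : 𝒢′|_K → 𝒢|_ℍ` AND `ι″(Π_{𝒢′}) = Stab_{Π_𝒢}(a)` — Remark 2.2.1 read once in `B(𝒢_ℍ)` and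
  once in `B(𝒢)` AT THE SAME POINT (the "tie" which «local ∧ global ∧ vertex-aligned» does not supply
  for an abstract `φ`, and which the construction side supplies for the covering of record
  `A.coveringHomCan`, abc-iut-L3-d3 RS-cov).

This file proves, for an ARBITRARY morphism `φ`:

* `covering_subgraphComponents_doubleCosets_body_of_stabilizers` — the BODY of (D3) (all four clauses,
  D3's binders) from «local ∧ global» and (ST);
* `covering_subgraphComponents_doubleCosets_of_stabilizers` — hence the named fact (D3) itself from the
  ∀-quantified (ST) (documentation of exactly what the abstract fact F-1487 needs beyond its hypotheses);
* `subgraphComponents_doubleCosets_coveringHomCan_of_stabilizers` — the instance at the covering of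
  record `φ := A.coveringHomCan : 𝒢_A → 𝒢`, in the binder shape `hD3cov` consumed by abc-iut-w4-d071's
  closer `corollary_2_7_i_of_subgraphComponents_doubleCosets_coveringHomCan`
  (`Corollary27iAtCoveringHomCan.lean`): so [SemiAnbd] Cor. 2.7 (i) / Rmk. 2.7.2 / Cor. 2.7 (ii) become
  kernel theorems the moment (ST) is proved for `coveringHomCan` (abc-iut-L3-d3).

Nothing here takes a side on [IUTchIII] Cor. 3.12; typed ≠ proved for (ST).
-/

namespace Literature.AnabelianGeometry.SemiGraphs

namespace SemiGraphOfAnabelioids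

open CategoryTheory CategoryTheory.Functor CategoryTheory.PreGaloisCategory
open Literature.AnabelianGeometry.Anabelioids
open scoped Pointwise

universe v₁ u₁ u

variable {𝒢 𝒢' : SemiGraphOfAnabelioids.{v₁, u₁, u}}

/-- **(D3), all four clauses, from matched stabilizers** ([SemiAnbd] p. 30 with Rem. 2.2.1 p. 24):
for `𝒢`, `𝒢′` connected, `φ : 𝒢′ → 𝒢` locally (`IsFiniteEtaleCoveringOf`) and globally
(`IsGlobalCoveringOf`) the covering attached to `A`, a connected sub-graph `ℍ ∋ v = φ v′`, basepoints
`(F′, F, e)` through `v′` and `Π′ = ι(Π_{𝒢′}) = Stab(x₀)`; ASSUME (ST): at every vertex `w″` of every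
preimage component `K` of `ℍ`, for all constituent basepoints `(F″, F₂, e₂)`, some point `a` of the
fibre of `A` has `ι_ψ(Π_K) = Stab_{Π_ℍ}(a)` (`ψ = φ|_K`) and `ι″(Π_{𝒢′}) = Stab_{Π_𝒢}(a)`.  THEN:
(P1) `K ↦ Π_ℍ d(K) Π′` is a bijection from the preimage components onto `Π_ℍ \ Π_𝒢 / Π′`, (P2) the
component through `v′` exists, (P3) it goes to the class of `Π′` and `ι(Π_{K₀}) = Π′ ∩ Π_ℍ`, (P4) at
every vertex of every component, through every transport `α`, `ι(Π_K) = Π′ ∩ g⁻¹ Π_ℍ g` for some `g`.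
((P1)(P2): `covering_subgraphComponents_count_one`; (P3): abc-iut-L6-t17's
`Hom.range_ι_comp_piHToPi_eq_inf_of_eq_stabilizer`; (P4): `Hom.exists_range_conj_piHToPi_eq_of_eq_stabilizer`.)
[cite: MochizukiSemiAnbd2006, Cor. 2.7(i) p.30] -/
theorem covering_subgraphComponents_doubleCosets_body_of_stabilizers
    (h𝒢 : 𝒢.IsConnected) (h𝒢' : 𝒢'.IsConnected) (φ : Hom 𝒢' 𝒢) (A : 𝒢.BObj)
    (hloc : φ.IsFiniteEtaleCoveringOf A) (hB : φ.IsGlobalCoveringOf A)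
    (v' : 𝒢'.graph.Vertex) (F' : 𝒢'.V v' ⥤ FintypeCat.{v₁}) [FiberFunctor F']
    (F : 𝒢.V (φ.base.vertexMap v') ⥤ FintypeCat.{v₁}) [FiberFunctor F]
    (e : (φ.φV v').pullback ⋙ F' ≅ F)
    (H : 𝒢.graph.Subgraph) (hH : H.toSemiGraph.IsConnected) (hHg : H.toSemiGraph.IsGraph)
    (hv : φ.base.vertexMap v' ∈ H.verts)
    (hST : ∀ (K : {K : 𝒢'.graph.Subgraph // φ.IsPreimageComponent H K})
      (w'' : K.1.toSemiGraph.Vertex) (F'' : 𝒢'.V w''.1 ⥤ FintypeCat.{v₁}) [FiberFunctor F'']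
      (F₂ : 𝒢.V (φ.base.vertexMap w''.1) ⥤ FintypeCat.{v₁}) [FiberFunctor F₂]
      (e₂ : (φ.φV w''.1).pullback ⋙ F'' ≅ F₂),
      ∃ a : (𝒢.ρ (φ.base.vertexMap w''.1) ⋙ F₂).obj A,
        ((Aut.autMulEquivOfIso
              (isoWhiskerLeft ((𝒢.restrict H).ρ ⟨φ.base.vertexMap w''.1, K.2.2.2.2.1 w''.2⟩)
                e₂)).toMonoidHom.comp
            (pi1Map (φ.restrict K.1 H K.2.2.2.2.1 K.2.2.2.2.2.1).pullbackFunctor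
              ((𝒢'.restrict K.1).ρ w'' ⋙ F''))).range =
          MulAction.stabilizer (𝒢.PiH H ⟨φ.base.vertexMap w''.1, K.2.2.2.2.1 w''.2⟩ F₂)
            (show ((𝒢.restrict H).ρ ⟨φ.base.vertexMap w''.1, K.2.2.2.2.1 w''.2⟩ ⋙ F₂).obj
              ((𝒢.restrictFunctor H).obj A) from a) ∧
        ((Aut.autMulEquivOfIso (isoWhiskerLeft (𝒢.ρ (φ.base.vertexMap w''.1)) e₂)).toMonoidHom.comp
            (pi1Map φ.pullbackFunctor (𝒢'.ρ w''.1 ⋙ F''))).range =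
          MulAction.stabilizer (𝒢.Pi (φ.base.vertexMap w''.1) F₂) a)
    (x₀ : (𝒢.ρ (φ.base.vertexMap v') ⋙ F).obj A)
    (hx₀ : ((Aut.autMulEquivOfIso (isoWhiskerLeft (𝒢.ρ (φ.base.vertexMap v')) e)
        ).toMonoidHom.comp (pi1Map φ.pullbackFunctor (𝒢'.ρ v' ⋙ F'))).range =
      MulAction.stabilizer (𝒢.Pi (φ.base.vertexMap v') F) x₀) :
    ∃ d : {K : 𝒢'.graph.Subgraph // φ.IsPreimageComponent H K} → 𝒢.Pi (φ.base.vertexMap v') F,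
      Function.Bijective (fun K => DoubleCoset.mk (𝒢.piHToPi H ⟨φ.base.vertexMap v', hv⟩ F).range
        ((Aut.autMulEquivOfIso (isoWhiskerLeft (𝒢.ρ (φ.base.vertexMap v')) e)
          ).toMonoidHom.comp (pi1Map φ.pullbackFunctor (𝒢'.ρ v' ⋙ F'))).range (d K)) ∧
      (∃ K₀ : {K : 𝒢'.graph.Subgraph // φ.IsPreimageComponent H K}, v' ∈ K₀.1.verts) ∧
      (∀ (K : {K : 𝒢'.graph.Subgraph // φ.IsPreimageComponent H K}) (hK : v' ∈ K.1.verts),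
        d K ∈ ((Aut.autMulEquivOfIso (isoWhiskerLeft (𝒢.ρ (φ.base.vertexMap v')) e)
            ).toMonoidHom.comp (pi1Map φ.pullbackFunctor (𝒢'.ρ v' ⋙ F'))).range ∧
          (((Aut.autMulEquivOfIso (isoWhiskerLeft (𝒢.ρ (φ.base.vertexMap v')) e)
              ).toMonoidHom.comp (pi1Map φ.pullbackFunctor (𝒢'.ρ v' ⋙ F'))).comp
              (𝒢'.piHToPi K.1 ⟨v', hK⟩ F')).range =
            ((Aut.autMulEquivOfIso (isoWhiskerLeft (𝒢.ρ (φ.base.vertexMap v')) e)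
                ).toMonoidHom.comp (pi1Map φ.pullbackFunctor (𝒢'.ρ v' ⋙ F'))).range ⊓
              (𝒢.piHToPi H ⟨φ.base.vertexMap v', hv⟩ F).range) ∧
      ∀ (K : {K : 𝒢'.graph.Subgraph // φ.IsPreimageComponent H K})
        (w'' : K.1.toSemiGraph.Vertex) (F'' : 𝒢'.V w''.1 ⥤ FintypeCat.{v₁}) [FiberFunctor F'']
        (α : 𝒢'.ρ w''.1 ⋙ F'' ≅ 𝒢'.ρ v' ⋙ F'),
        ∃ g : 𝒢.Pi (φ.base.vertexMap v') F,
          (((Aut.autMulEquivOfIso (isoWhiskerLeft (𝒢.ρ (φ.base.vertexMap v')) e)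
              ).toMonoidHom.comp (pi1Map φ.pullbackFunctor (𝒢'.ρ v' ⋙ F'))).comp
              ((Aut.autMulEquivOfIso α).toMonoidHom.comp (𝒢'.piHToPi K.1 w'' F''))).range =
            ((Aut.autMulEquivOfIso (isoWhiskerLeft (𝒢.ρ (φ.base.vertexMap v')) e)
                ).toMonoidHom.comp (pi1Map φ.pullbackFunctor (𝒢'.ρ v' ⋙ F'))).range ⊓
              ConjAct.toConjAct g⁻¹ • (𝒢.piHToPi H ⟨φ.base.vertexMap v', hv⟩ F).range := by
  -- (P1) + (P2), with the component through `v′` represented by `1`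
  obtain ⟨d, hd, K₀, hK₀, hd1⟩ :=
    covering_subgraphComponents_count_one h𝒢 h𝒢' φ A hloc hB v' F H hH hHg hv x₀
  refine ⟨d, ?_, ⟨K₀, hK₀⟩, ?_, ?_⟩
  · rw [hx₀]
    exact hd
  · -- (P3): the component through `v′` is `K₀` (uniqueness), `d K₀ = 1`; the range identity is the
    -- bridge at the matched point
    intro K hK
    have hKK₀ : K = K₀ := Subtype.ext (Hom.IsPreimageComponent.eq_of_mem K.2 K₀.2 hK hK₀)
    refine ⟨?_, ?_⟩
    · rw [hKK₀, hd1]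
      exact one_mem _
    · obtain ⟨a, hψ, hι⟩ := hST K ⟨v', hK⟩ F' F e
      rw [hι]
      exact φ.range_ι_comp_piHToPi_eq_inf_of_eq_stabilizer K.1 H K.2.2.2.2.1 K.2.2.2.2.2.1
        ⟨v', hK⟩ F' F e A a hψ
  · -- (P4): basepoint transport from the matched stabilizers at `w″`
    intro K w'' F'' _ α
    haveI : Limits.PreservesFiniteLimits (φ.φV w''.1).pullback := (φ.φV w''.1).property.1
    haveI : Limits.PreservesFiniteColimits (φ.φV w''.1).pullback := (φ.φV w''.1).property.2
    haveI : FiberFunctor ((φ.φV w''.1).pullback ⋙ F'') :=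
      fiberFunctor_comp_of_exact (φ.φV w''.1).pullback F''
    obtain ⟨a, hψ, hι⟩ := hST K w'' F'' ((φ.φV w''.1).pullback ⋙ F'') (Iso.refl _)
    exact φ.exists_range_conj_piHToPi_eq_of_eq_stabilizer K.1 H hH K.2.2.2.2.1 K.2.2.2.2.2.1
      v' F' F e hv w'' F'' ((φ.φV w''.1).pullback ⋙ F'') (Iso.refl _) A a hψ hι α

/-- **The abstract dictionary fact (D3) from matched stabilizers**: if (ST) holds for EVERY
locally/globally attached, vertex-aligned finite étale covering `φ` (at every vertex of every preimage
component of every connected sub-graph), then `covering_subgraphComponents_doubleCosets` (F-1487) holds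
— i.e. (ST) is exactly the input the abstract fact needs beyond its own hypotheses.
[cite: MochizukiSemiAnbd2006, Cor. 2.7(i) p.30] -/
theorem covering_subgraphComponents_doubleCosets_of_stabilizers
    (hST : ∀ (𝒢 𝒢' : SemiGraphOfAnabelioids.{v₁, u₁, u}) (φ : Hom 𝒢' 𝒢) (A : 𝒢.BObj),
      𝒢.IsConnected → 𝒢'.IsConnected → φ.IsFiniteEtaleCoveringOf A → φ.IsGlobalCoveringOf A →
      φ.IsVertexAligned →
      ∀ (H : 𝒢.graph.Subgraph), H.toSemiGraph.IsConnected → H.toSemiGraph.IsGraph →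
      ∀ (K : {K : 𝒢'.graph.Subgraph // φ.IsPreimageComponent H K})
        (w'' : K.1.toSemiGraph.Vertex) (F'' : 𝒢'.V w''.1 ⥤ FintypeCat.{v₁}) [FiberFunctor F'']
        (F₂ : 𝒢.V (φ.base.vertexMap w''.1) ⥤ FintypeCat.{v₁}) [FiberFunctor F₂]
        (e₂ : (φ.φV w''.1).pullback ⋙ F'' ≅ F₂),
        ∃ a : (𝒢.ρ (φ.base.vertexMap w''.1) ⋙ F₂).obj A,
          ((Aut.autMulEquivOfIso
                (isoWhiskerLeft ((𝒢.restrict H).ρ ⟨φ.base.vertexMap w''.1, K.2.2.2.2.1 w''.2⟩)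
                  e₂)).toMonoidHom.comp
              (pi1Map (φ.restrict K.1 H K.2.2.2.2.1 K.2.2.2.2.2.1).pullbackFunctor
                ((𝒢'.restrict K.1).ρ w'' ⋙ F''))).range =
            MulAction.stabilizer (𝒢.PiH H ⟨φ.base.vertexMap w''.1, K.2.2.2.2.1 w''.2⟩ F₂)
              (show ((𝒢.restrict H).ρ ⟨φ.base.vertexMap w''.1, K.2.2.2.2.1 w''.2⟩ ⋙ F₂).obj
                ((𝒢.restrictFunctor H).obj A) from a) ∧
          ((Aut.autMulEquivOfIso (isoWhiskerLeft (𝒢.ρ (φ.base.vertexMap w''.1)) e₂)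
              ).toMonoidHom.comp (pi1Map φ.pullbackFunctor (𝒢'.ρ w''.1 ⋙ F''))).range =
            MulAction.stabilizer (𝒢.Pi (φ.base.vertexMap w''.1) F₂) a) :
    covering_subgraphComponents_doubleCosets.{v₁, u₁, u} := by
  intro 𝒢 𝒢' φ A h𝒢 h𝒢' hloc hB hal v' F' _ F _ e H hH hHg hv
  dsimp only
  intro x₀ hx₀
  exact covering_subgraphComponents_doubleCosets_body_of_stabilizers h𝒢 h𝒢' φ A hloc hB v' F' F e
    H hH hHg hv (fun K w'' F'' _ F₂ _ e₂ => hST 𝒢 𝒢' φ A h𝒢 h𝒢' hloc hB hal H hH hHg K w'' F'' F₂ e₂)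
    x₀ hx₀

/-- **(D3) at the covering of record `𝒢_A → 𝒢` from matched stabilizers** — the hypothesis `hD3cov` of
abc-iut-w4-d071's `corollary_2_7_i_of_subgraphComponents_doubleCosets_coveringHomCan`
(`Corollary27iAtCoveringHomCan.lean`: (D3)'s binders VERBATIM with `𝒢′ := A.coveringGraph`,
`φ := A.coveringHomCan`), derived from (ST) for `A.coveringHomCan` (abc-iut-L3-d3's construction-side
input: at every vertex `w″` of every preimage component `K` of a connected sub-graph `ℍ`, one point `a`
of the fibre of `A` with `ι_ψ(Π_K) = Stab_{Π_ℍ}(a)`, `ψ = A.coveringHomCan|_K`, and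
`ι″(Π_{𝒢_A}) = Stab_{Π_𝒢}(a)`). [cite: MochizukiSemiAnbd2006, Cor. 2.7(i) p.30] -/
theorem subgraphComponents_doubleCosets_coveringHomCan_of_stabilizers
    (hSTcov : ∀ (𝒢 : SemiGraphOfAnabelioids.{v₁, u₁, u}) (A : 𝒢.BObj),
      𝒢.IsConnected → A.coveringGraph.IsConnected →
      ∀ (H : 𝒢.graph.Subgraph), H.toSemiGraph.IsConnected → H.toSemiGraph.IsGraph →
      ∀ (K : {K : A.coveringGraph.graph.Subgraph // A.coveringHomCan.IsPreimageComponent H K})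
        (w'' : K.1.toSemiGraph.Vertex) (F'' : A.coveringGraph.V w''.1 ⥤ FintypeCat.{v₁})
        [FiberFunctor F'']
        (F₂ : 𝒢.V (A.coveringHomCan.base.vertexMap w''.1) ⥤ FintypeCat.{v₁}) [FiberFunctor F₂]
        (e₂ : (A.coveringHomCan.φV w''.1).pullback ⋙ F'' ≅ F₂),
        ∃ a : (𝒢.ρ (A.coveringHomCan.base.vertexMap w''.1) ⋙ F₂).obj A,
          ((Aut.autMulEquivOfIso
                (isoWhiskerLeft
                  ((𝒢.restrict H).ρ ⟨A.coveringHomCan.base.vertexMap w''.1, K.2.2.2.2.1 w''.2⟩)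
                  e₂)).toMonoidHom.comp
              (pi1Map (A.coveringHomCan.restrict K.1 H K.2.2.2.2.1 K.2.2.2.2.2.1).pullbackFunctor
                ((A.coveringGraph.restrict K.1).ρ w'' ⋙ F''))).range =
            MulAction.stabilizer
              (𝒢.PiH H ⟨A.coveringHomCan.base.vertexMap w''.1, K.2.2.2.2.1 w''.2⟩ F₂)
              (show ((𝒢.restrict H).ρ ⟨A.coveringHomCan.base.vertexMap w''.1, K.2.2.2.2.1 w''.2⟩ ⋙
                F₂).obj ((𝒢.restrictFunctor H).obj A) from a) ∧
          ((Aut.autMulEquivOfIso (isoWhiskerLeft (𝒢.ρ (A.coveringHomCan.base.vertexMap w''.1)) e₂)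
              ).toMonoidHom.comp
              (pi1Map A.coveringHomCan.pullbackFunctor (A.coveringGraph.ρ w''.1 ⋙ F''))).range =
            MulAction.stabilizer (𝒢.Pi (A.coveringHomCan.base.vertexMap w''.1) F₂) a) :
    ∀ (𝒢 : SemiGraphOfAnabelioids.{v₁, u₁, u}) (A : 𝒢.BObj),
      𝒢.IsConnected → A.coveringGraph.IsConnected → A.coveringHomCan.IsFiniteEtaleCoveringOf A →
      A.coveringHomCan.IsGlobalCoveringOf A → A.coveringHomCan.IsVertexAligned →
      ∀ (v' : A.coveringGraph.graph.Vertex) (F' : A.coveringGraph.V v' ⥤ FintypeCat.{v₁})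
        [FiberFunctor F'] (F : 𝒢.V (A.coveringHomCan.base.vertexMap v') ⥤ FintypeCat.{v₁})
        [FiberFunctor F] (e : (A.coveringHomCan.φV v').pullback ⋙ F' ≅ F)
        (H : 𝒢.graph.Subgraph), H.toSemiGraph.IsConnected → H.toSemiGraph.IsGraph →
        ∀ (hv : A.coveringHomCan.base.vertexMap v' ∈ H.verts),
        let v := A.coveringHomCan.base.vertexMap v'
        let ι : A.coveringGraph.Pi v' F' →* 𝒢.Pi v F :=
          (Aut.autMulEquivOfIso (Functor.isoWhiskerLeft (𝒢.ρ v) e)).toMonoidHom.comp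
            (pi1Map A.coveringHomCan.pullbackFunctor (A.coveringGraph.ρ v' ⋙ F'))
        let PH : Subgroup (𝒢.Pi v F) := (𝒢.piHToPi H ⟨v, hv⟩ F).range
        ∀ x₀ : (𝒢.ρ v ⋙ F).obj A, ι.range = MulAction.stabilizer (𝒢.Pi v F) x₀ →
          ∃ d : {K : A.coveringGraph.graph.Subgraph // A.coveringHomCan.IsPreimageComponent H K} →
              𝒢.Pi v F,
            Function.Bijective (fun K => DoubleCoset.mk PH ι.range (d K)) ∧
            (∃ K₀ : {K : A.coveringGraph.graph.Subgraph // A.coveringHomCan.IsPreimageComponent H K},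
              v' ∈ K₀.1.verts) ∧
            (∀ (K : {K : A.coveringGraph.graph.Subgraph // A.coveringHomCan.IsPreimageComponent H K})
              (hK : v' ∈ K.1.verts),
              d K ∈ ι.range ∧
                (ι.comp (A.coveringGraph.piHToPi K.1 ⟨v', hK⟩ F')).range = ι.range ⊓ PH) ∧
            ∀ (K : {K : A.coveringGraph.graph.Subgraph // A.coveringHomCan.IsPreimageComponent H K})
              (w'' : K.1.toSemiGraph.Vertex) (F'' : A.coveringGraph.V w''.1 ⥤ FintypeCat.{v₁})
              [FiberFunctor F''] (α : A.coveringGraph.ρ w''.1 ⋙ F'' ≅ A.coveringGraph.ρ v' ⋙ F'),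
              ∃ g : 𝒢.Pi v F,
                (ι.comp ((Aut.autMulEquivOfIso α).toMonoidHom.comp
                  (A.coveringGraph.piHToPi K.1 w'' F''))).range =
                    ι.range ⊓ ConjAct.toConjAct g⁻¹ • PH := by
  intro 𝒢 A h𝒢 h𝒢' hloc hB _ v' F' _ F _ e H hH hHg hv
  dsimp only
  intro x₀ hx₀
  exact covering_subgraphComponents_doubleCosets_body_of_stabilizers h𝒢 h𝒢' A.coveringHomCan A hloc hB
    v' F' F e H hH hHg hv (fun K w'' F'' _ F₂ _ e₂ => hSTcov 𝒢 A h𝒢 h𝒢' H hH hHg K w'' F'' F₂ e₂) x₀ hx₀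

end SemiGraphOfAnabelioids

end Literature.AnabelianGeometry.SemiGraphs
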